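import Summits.BirchSwinnertonDyer.BirchSwinnertonDyer.Theorems.ByReductionTypeAtTwoAdditivePotMultConjATwoNarrowRoadKit
import Literature.NumberTheory.NumberFields.CyclotomicTwoTowerLayerPolynomials
import HarnessLib

/-!
# C4″ `AdditivePotMultOverKAtTwo` (item stmt-BirchSwinnertonDyer-22618), the (I1M′) input on the `0 < Δ` rows:
# the NARROW-ROAD KIT, part E (LAYER TWO) — the second cyclotomic layer `A₂ = ℚ(θ) ⊔ ℚ_2 = ℚ(θ, √(2+√2))` of ANY totally real
# cubic field: totally real of degree `12`, and its twelve real embeddings realise every pair `(φ, z)`, `Ψ₂(z) = 0`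

Cell `bsd-2adic`, rung K4, seat `bsd-2adic-k4-w3` GEN 13 (explicit unit of director-bsd g16 (309)(7); `--supports stmt-BirchSwinnertonDyer-22618`).
HONEST FRAMING (D-0036/D-0054/D-0152): THEOREMS ONLY (no definition, no named fact, no `sorry`, no instance). Generic plumbing for the
NARROW-EQUAL12 rows of C4″ (rung `m = 1` of cruxlead-19573-w2's `NarrowRankRung.conjA_two_cubicModel_of_narrowRank_layer_models_eq`:
ONE equality `[Cl⁺(A₂) : Cl⁺(A₂)²] = [Cl⁺(A₁) : Cl⁺(A₁)²]`); closes nothing at the `∀`-level (C4″ / (I1M′) stay research-open); nothing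
booked; BSD is not proved by any of this.

This is k4-w1 GEN 11's `layer_two_basics_d316` / `exists_ringHom_sup_layer_two_d316` (row `261648q1`,
`…NarrowRankCertificate316LayerTwo`) with the cubic `⟨1, p, q, r⟩` freed — the proofs never used the particular cubic, only
irreducibility and total reality (the layer-`2` twin of part A's `layer_one_basics` / `exists_ringHom_sup_layer_one`):

* `layer_two_basics` — `A₂` totally real, `[A₂ : ℚ] = 12`, `[ℚ(θ) : ℚ] = 3` (restricted cyclotomic `ℤ₂`-tower of the odd-degree field
  `ℚ(θ)`, layer `2`).
* `exists_ringHom_sup_layer_two` — for any root `e ∈ ℚ_2` of `Ψ₂ = X⁴ − 4X² + 2`: `A₂ = ℚ(θ)(e)` (`Ψ₂` stays irreducible over the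
  odd-degree field, `NestedSqrtTwo.finrank_adjoin_eq_of_odd_finrank`), so `ρ ↦ (ρ|_{ℚ(θ)}, ρ(e))` is injective on the `12` real embeddings
  with image in `Emb(ℚ(θ)) × {real roots of Ψ₂}` (`≤ 3·4` elements): every pair `(φ, z)` is realised.
(`e² − 2 ∈ ℚ_1`, `(e² − 2)² = 2` is k4-w1's field-independent `sq_sub_two_mem_layer_one_d316`, reused by name downstream.)

References: [Washington1997] §13.1 (`ℚ_2 = ℚ(ζ₁₆)⁺`, `K_n = Kℚ_n`), Prop. 13.2; [FrohlichTaylor1990] Ch. V §1; [Cohen1993] §4.1.3.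
-/

set_option autoImplicit false
-- sibling precedent (`…NarrowRoadKit.lean`): the directory name repeats the summit name
set_option linter.dupNamespace false

noncomputable section

open scoped Classical IntermediateField NumberField Polynomial

namespace Summit.BirchSwinnertonDyer.BirchSwinnertonDyer.Theorems.AddKatoTwo

open Polynomial IsDedekindDomain NumberField Field IntermediateField
  Literature.NumberTheory.EllipticCurves Literature.NumberTheory.EllipticCurves.ZpExtension
  Literature.NumberTheory.IwasawaTheory Literature.NumberTheory.NumberFields
  Literature.NumberTheory.GaloisRepresentations Literature.Geometry.Kaehler.ComplexTorus

section LayerTwo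

variable {p q r : ℤ} {θ : AlgebraicClosure ℚ}

set_option maxHeartbeats 400000 in
/-- **The basic data of `A₂ = ℚ(θ) ⊔ ℚ_2` : totally real, degree `12`, and `[ℚ(θ):ℚ] = 3`** — from the restricted cyclotomic
`ℤ₂`-tower of `ℚ(θ)` (odd degree): its second layer is `≅ ℚ(θ) ⊔ ℚ_2`, totally real as a layer of a `ℤ₂`-extension of a totally real field, of
degree `3·2²`. [cite: Washington1997, §13.1 and Prop. 13.2] -/
theorem layer_two_basics (hirr : Irreducible (Cubic.toPoly ⟨1, (p : ℚ), q, r⟩))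
    (hθ : aeval θ (Cubic.toPoly ⟨1, (p : ℚ), q, r⟩) = 0)
    (hreal : haveI : FiniteDimensional ℚ ↥ℚ⟮θ⟯ :=
        IntermediateField.adjoin.finiteDimensional ⟨_, Cubic.monic_of_a_eq_one', by rwa [← aeval_def]⟩
      haveI : NumberField ↥ℚ⟮θ⟯ := NumberField.mk
      IsTotallyReal ↥ℚ⟮θ⟯) :
    haveI : FiniteDimensional ℚ ↥ℚ⟮θ⟯ :=
      IntermediateField.adjoin.finiteDimensional ⟨_, Cubic.monic_of_a_eq_one', by rwa [← aeval_def]⟩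
    haveI : FiniteDimensional ℚ ↥((CyclotomicZp.zpExtension 2).layer 2) := (CyclotomicZp.zpExtension 2).finiteDimensional_layer_holds 2
    haveI : NumberField ↥(ℚ⟮θ⟯ ⊔ (CyclotomicZp.zpExtension 2).layer 2) := NumberField.mk
    IsTotallyReal ↥(ℚ⟮θ⟯ ⊔ (CyclotomicZp.zpExtension 2).layer 2) ∧
      Module.finrank ℚ ↥(ℚ⟮θ⟯ ⊔ (CyclotomicZp.zpExtension 2).layer 2) = 12 ∧ Module.finrank ℚ ↥ℚ⟮θ⟯ = 3 := by
  haveI : FiniteDimensional ℚ ↥ℚ⟮θ⟯ :=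
    IntermediateField.adjoin.finiteDimensional ⟨_, Cubic.monic_of_a_eq_one', by rwa [← aeval_def]⟩
  haveI : FiniteDimensional ℚ ↥((CyclotomicZp.zpExtension 2).layer 2) := (CyclotomicZp.zpExtension 2).finiteDimensional_layer_holds 2
  haveI : NumberField ↥ℚ⟮θ⟯ := NumberField.mk
  haveI : NumberField ↥(ℚ⟮θ⟯ ⊔ (CyclotomicZp.zpExtension 2).layer 2) := NumberField.mk
  haveI : IsTotallyReal ↥ℚ⟮θ⟯ := hreal
  set κ := CyclotomicZp.zpExtension 2 with hκdef
  have h3 : Module.finrank ℚ ↥ℚ⟮θ⟯ = 3 := finrank_adjoin_eq_three_of_irreducible hirr hθ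
  have hodd3 : Odd (Module.finrank ℚ ↥ℚ⟮θ⟯) := by rw [h3]; decide
  have hsurj := surjective_comp_absGaloisRestrict_cyclotomicZp_of_odd ℚ⟮θ⟯ hodd3
  set κE := κ.restrict ↥ℚ⟮θ⟯ hsurj with hκE
  haveI : FiniteDimensional ↥ℚ⟮θ⟯ (κE.layer 2) := κE.finiteDimensional_layer_holds 2
  haveI : NumberField (κE.layer 2) := NumberField.of_module_finite ↥ℚ⟮θ⟯ _
  obtain ⟨f⟩ := nonempty_algEquiv_layer_restrict_fieldRange_sup_layer κ ↥ℚ⟮θ⟯ hsurj (ℚ⟮θ⟯).val 2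
  have hrange : (ℚ⟮θ⟯).val.fieldRange ⊔ κ.layer 2 = ℚ⟮θ⟯ ⊔ κ.layer 2 := by rw [fieldRange_val]
  set e : ↥(κE.layer 2) ≃ₐ[ℚ] ↥(ℚ⟮θ⟯ ⊔ κ.layer 2) := f.trans (equivOfEq hrange) with hedef
  haveI : IsTotallyReal ↥(κE.layer 2) := isTotallyReal_layer κE 2
  refine ⟨IsTotallyReal.ofRingEquiv e.toRingEquiv, ?_, h3⟩
  rw [← e.toLinearEquiv.finrank_eq, finrank_layer_restrict κ ↥ℚ⟮θ⟯ hsurj 2, h3]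
  norm_num

set_option maxHeartbeats 800000 in
/-- **The real embeddings of `A₂ = ℚ(θ) ⊔ ℚ_2`  realise every pair `(φ, z)`**, `φ` a real embedding of `ℚ(θ)` and `z` a real root of
`Ψ₂ = X⁴ − 4X² + 2`, for any root `e ∈ ℚ_2` of `Ψ₂`: `A₂ = ℚ(θ)(e)` (`[ℚ(θ)(e) : ℚ(θ)] = 4`, `Ψ₂` irreducible over the cubic field), so
`ρ ↦ (ρ|_{ℚ(θ)}, ρ(e))` is injective on the `12` real embeddings, with image in `Emb(ℚ(θ)) × {roots of Ψ₂ in ℝ}`, a set of at most `12` elements.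
[cite: FrohlichTaylor1990, Ch. V §1 ("the embeddings N ↪ ℝ"), p. 163] [cite: Washington1997, §13.1] [cite: Cohen1993, §4.1.3] -/
theorem exists_ringHom_sup_layer_two (hirr : Irreducible (Cubic.toPoly ⟨1, (p : ℚ), q, r⟩))
    (hθ : aeval θ (Cubic.toPoly ⟨1, (p : ℚ), q, r⟩) = 0)
    (hreal : haveI : FiniteDimensional ℚ ↥ℚ⟮θ⟯ :=
        IntermediateField.adjoin.finiteDimensional ⟨_, Cubic.monic_of_a_eq_one', by rwa [← aeval_def]⟩
      haveI : NumberField ↥ℚ⟮θ⟯ := NumberField.mk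
      IsTotallyReal ↥ℚ⟮θ⟯)
    {e : AlgebraicClosure ℚ} (he : e ∈ (CyclotomicZp.zpExtension 2).layer 2) (he0 : (fun x : AlgebraicClosure ℚ => x ^ 2 - 2)^[2] e = 0)
    (φ : ↥ℚ⟮θ⟯ →+* ℝ) (z : ℝ) (hz : (fun x : ℝ => x ^ 2 - 2)^[2] z = 0) :
    ∃ ρ : ↥(ℚ⟮θ⟯ ⊔ (CyclotomicZp.zpExtension 2).layer 2) →+* ℝ,
      (∀ c : ↥ℚ⟮θ⟯, ρ (inclusion (le_sup_left : ℚ⟮θ⟯ ≤ ℚ⟮θ⟯ ⊔ (CyclotomicZp.zpExtension 2).layer 2) c) = φ c) ∧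
      ρ ⟨e, (le_sup_right : (CyclotomicZp.zpExtension 2).layer 2 ≤ _) he⟩ = z := by
  haveI : FiniteDimensional ℚ ↥ℚ⟮θ⟯ :=
    IntermediateField.adjoin.finiteDimensional ⟨_, Cubic.monic_of_a_eq_one', by rwa [← aeval_def]⟩
  haveI : FiniteDimensional ℚ ↥((CyclotomicZp.zpExtension 2).layer 2) := (CyclotomicZp.zpExtension 2).finiteDimensional_layer_holds 2
  haveI : NumberField ↥ℚ⟮θ⟯ := NumberField.mk
  haveI : NumberField ↥(ℚ⟮θ⟯ ⊔ (CyclotomicZp.zpExtension 2).layer 2) := NumberField.mk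
  obtain ⟨hreal2, hfinA, h3⟩ := layer_two_basics hirr hθ hreal
  haveI := hreal2
  have hodd3 : Odd (Module.finrank ℚ ↥ℚ⟮θ⟯) := by rw [h3]; decide
  have hKA : ℚ⟮θ⟯ ≤ ℚ⟮θ⟯ ⊔ ((CyclotomicZp.zpExtension 2).layer 2) := le_sup_left
  have heA : e ∈ ℚ⟮θ⟯ ⊔ ((CyclotomicZp.zpExtension 2).layer 2) :=
    (le_sup_right : ((CyclotomicZp.zpExtension 2).layer 2) ≤ ℚ⟮θ⟯ ⊔ ((CyclotomicZp.zpExtension 2).layer 2)) he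
  set e' : ↥(ℚ⟮θ⟯ ⊔ ((CyclotomicZp.zpExtension 2).layer 2)) := ⟨e, heA⟩ with he'def
  have he'0 : (fun x : ↥(ℚ⟮θ⟯ ⊔ ((CyclotomicZp.zpExtension 2).layer 2)) => x ^ 2 - 2)^[2] e' = 0 := by
    apply (algebraMap ↥(ℚ⟮θ⟯ ⊔ ((CyclotomicZp.zpExtension 2).layer 2)) (AlgebraicClosure ℚ)).injective
    rw [NestedSqrtTwo.map_iterate, map_zero]
    exact he0
  letI : Algebra ℚ⟮θ⟯ ↥(ℚ⟮θ⟯ ⊔ ((CyclotomicZp.zpExtension 2).layer 2)) := (inclusion hKA).toRingHom.toAlgebra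
  have halg : ∀ c : ℚ⟮θ⟯, algebraMap ℚ⟮θ⟯ ↥(ℚ⟮θ⟯ ⊔ ((CyclotomicZp.zpExtension 2).layer 2)) c = inclusion hKA c := fun _ => rfl
  haveI : IsScalarTower ℚ ℚ⟮θ⟯ ↥(ℚ⟮θ⟯ ⊔ ((CyclotomicZp.zpExtension 2).layer 2)) :=
    IsScalarTower.of_algebraMap_eq fun q => ((inclusion hKA).commutes q).symm
  haveI : Module.Finite ℚ⟮θ⟯ ↥(ℚ⟮θ⟯ ⊔ ((CyclotomicZp.zpExtension 2).layer 2)) := Module.Finite.of_restrictScalars_finite ℚ ℚ⟮θ⟯ _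
  have hdeg : Module.finrank ℚ⟮θ⟯ ↥(ℚ⟮θ⟯ ⊔ ((CyclotomicZp.zpExtension 2).layer 2)) = 4 := by
    have htower := Module.finrank_mul_finrank ℚ ℚ⟮θ⟯ ↥(ℚ⟮θ⟯ ⊔ ((CyclotomicZp.zpExtension 2).layer 2))
    rw [h3, hfinA] at htower
    omega
  -- `A₂ = ℚ(θ)(e')`
  have htint : IsIntegral ℚ⟮θ⟯ e' := (Algebra.IsIntegral.isIntegral (R := ℚ) e').tower_top
  have hgen : IntermediateField.adjoin ℚ⟮θ⟯ ({e'} : Set ↥(ℚ⟮θ⟯ ⊔ ((CyclotomicZp.zpExtension 2).layer 2))) = ⊤ := by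
    refine IntermediateField.eq_of_le_of_finrank_eq le_top ?_
    rw [NestedSqrtTwo.finrank_adjoin_eq_of_odd_finrank hodd3 e' he'0, IntermediateField.finrank_top', hdeg]
    norm_num
  have hpoly : ∀ w : ↥(ℚ⟮θ⟯ ⊔ ((CyclotomicZp.zpExtension 2).layer 2)), ∃ f : ℚ⟮θ⟯[X], w = aeval e' f := by
    intro w
    have hw : w ∈ (IntermediateField.adjoin ℚ⟮θ⟯ ({e'} : Set ↥(ℚ⟮θ⟯ ⊔ ((CyclotomicZp.zpExtension 2).layer 2)))).toSubalgebra := by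
      rw [hgen, IntermediateField.top_toSubalgebra]; exact Algebra.mem_top
    rw [IntermediateField.adjoin_simple_toSubalgebra_of_isAlgebraic htint.isAlgebraic, Algebra.adjoin_singleton_eq_range_aeval] at hw
    obtain ⟨f, hf⟩ := hw
    exact ⟨f, hf.symm⟩
  have hinj : ∀ ρ ρ' : ↥(ℚ⟮θ⟯ ⊔ ((CyclotomicZp.zpExtension 2).layer 2)) →+* ℝ,
      ρ.comp (algebraMap ℚ⟮θ⟯ ↥(ℚ⟮θ⟯ ⊔ ((CyclotomicZp.zpExtension 2).layer 2))) =
        ρ'.comp (algebraMap ℚ⟮θ⟯ ↥(ℚ⟮θ⟯ ⊔ ((CyclotomicZp.zpExtension 2).layer 2))) → ρ e' = ρ' e' → ρ = ρ' := by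
    intro ρ ρ' hc hval
    refine RingHom.ext fun w => ?_
    obtain ⟨f, rfl⟩ := hpoly w
    rw [aeval_def, hom_eval₂, hom_eval₂, hc, hval]
  -- the real roots of `Ψ₂`
  set T : Finset ℝ := (((X ^ 2 - C 2 : ℝ[X]).comp)^[2] X).roots.toFinset with hT
  have hTcard : T.card ≤ 4 := by
    refine (Multiset.toFinset_card_le _).trans ?_
    have h := Polynomial.card_roots' (((X ^ 2 - C 2 : ℝ[X]).comp)^[2] X)
    rwa [NestedSqrtTwo.natDegree_eq] at h
  have hmemT : ∀ w : ℝ, (fun x : ℝ => x ^ 2 - 2)^[2] w = 0 → w ∈ T := by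
    intro w hw
    rw [hT, Multiset.mem_toFinset, Polynomial.mem_roots (NestedSqrtTwo.ne_zero 2), Polynomial.IsRoot.def,
      NestedSqrtTwo.eval_eq_iterate]
    exact hw
  -- counting
  have hcardA : Fintype.card (↥(ℚ⟮θ⟯ ⊔ ((CyclotomicZp.zpExtension 2).layer 2)) →+* ℝ) = 12 := by rw [card_realEmbeddings, hfinA]
  haveI : IsTotallyReal ↥ℚ⟮θ⟯ := hreal
  have hcardK : Fintype.card (↥ℚ⟮θ⟯ →+* ℝ) = 3 := by rw [card_realEmbeddings, h3]
  set Φ : (↥(ℚ⟮θ⟯ ⊔ ((CyclotomicZp.zpExtension 2).layer 2)) →+* ℝ) → (↥ℚ⟮θ⟯ →+* ℝ) × ℝ :=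
    fun ρ => (ρ.comp (algebraMap ℚ⟮θ⟯ ↥(ℚ⟮θ⟯ ⊔ ((CyclotomicZp.zpExtension 2).layer 2))), ρ e') with hΦ
  set S : Finset ((↥ℚ⟮θ⟯ →+* ℝ) × ℝ) := (Finset.univ : Finset (↥ℚ⟮θ⟯ →+* ℝ)) ×ˢ T with hS
  have hΦinj : Function.Injective Φ := fun ρ ρ' h => hinj ρ ρ' (congrArg Prod.fst h) (congrArg Prod.snd h)
  have hsub : Finset.univ.image Φ ⊆ S := by
    intro p hp
    obtain ⟨ρ, -, rfl⟩ := Finset.mem_image.mp hp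
    rw [hS, Finset.mem_product]
    refine ⟨Finset.mem_univ _, hmemT _ ?_⟩
    rw [← NestedSqrtTwo.map_iterate, he'0, map_zero]
  have hcardS : S.card ≤ 12 := by
    rw [hS, Finset.card_product, Finset.card_univ, hcardK]
    omega
  have hcardI : (Finset.univ.image Φ).card = 12 := by
    rw [Finset.card_image_of_injective _ hΦinj, Finset.card_univ, hcardA]
  have heq : Finset.univ.image Φ = S := Finset.eq_of_subset_of_card_le hsub (by rw [hcardI]; exact hcardS)
  have hmem : (φ, z) ∈ Finset.univ.image Φ := by
    rw [heq, hS, Finset.mem_product]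
    exact ⟨Finset.mem_univ _, hmemT z hz⟩
  obtain ⟨ρ, -, hρ⟩ := Finset.mem_image.mp hmem
  refine ⟨ρ, fun c => ?_, congrArg Prod.snd hρ⟩
  have h1 := congrArg Prod.fst hρ
  simp only [hΦ] at h1
  rw [← halg, ← RingHom.comp_apply, h1]

end LayerTwo

end Summit.BirchSwinnertonDyer.BirchSwinnertonDyer.Theorems.AddKatoTwo

end
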